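import Literature.NumberTheory.Rogawski1990.ArchCentralLimitFormula            -- ★ p842205: the letter `ArchCentralLimitFormulaRankTwo` (`[Field L]`-general, as registered in `stub_L21`)
import Literature.NumberTheory.Automorphic.ArchLocalDiagonalSignFrame          -- (this seat): the sign-pattern frame, torus-preserving `≃ₜ*`, integral transport
import Literature.NumberTheory.Automorphic.ArchLocalRegularOrbitClosed         -- ★ `locallyCompactSpace_archLocal`, `secondCountableTopology_archLocal`
import HarnessLib

/-!
# ROAD A, brick (G): `ArchCentralLimitFormulaRankTwo` DEPENDS ONLY ON THE SIGN PATTERN of `re σ_w(α)` — the letter at one frame (e.g. a CM instance, where the in-house (J-nc) chain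
# lives) implies the letter at EVERY frame `(L, α, w)` with the same signs (LEAD F0P3a-plan (g10) WORD T9-15 (3); Rogawski 1990 §8.4 p. 126: the statement is about `U(2,1)`)

Topic `NumberTheory/Rogawski1990`; namespace `Literature.NumberTheory.Rogawski1990`.  THEOREMS ONLY (no `def`, no instance, no notation, no axiom, no named fact, no `sorry`).
Cell `pub/hodgecm-mathlib`, ENGINE T1 (crux H413 = `stmt-HodgeConjecture-24833`); the registered stubs `stub_L21` (closer ED. 25 :647) ∕ `stub_ArchCentralLimitU21` («SdArch» ED. 3 :213)
quantify `∀ (L : Type) [Field L]`, while ★ `archLimitFormulaNoncompactWall_holds` (hence the `S±`-half of ROAD A, ★ p843187) is CM-only (finding A-p18 (g25) 09:46Z, REF1 R1-357,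
WORD T9-15 (3): «(G) … zero closer events»).  THIS FILE is (G): **`archCentralLimitFormulaRankTwo_of_signs`** — if `re σ_w(α_i) · re σ_{w₀}(α₀_i) > 0` for all `i` (both real), then
`ArchCentralLimitFormulaRankTwo L₀ α₀ w₀ → ArchCentralLimitFormulaRankTwo L α w`.  PROOF: the sign frame `T = diag(√(a₀_i∕a_i))` (★ `exists_continuousMulEquiv_archLocal_of_signs`) gives
`e : G₀ ≃ₜ* G`, `e u = TuT⁻¹`, `e(t z) = t z`; a Haar measure `ν` on `G` pulls back to the Haar measure `ν₀ = ν.map e⁻¹` on `G₀`; a test function `Θ` on `G` becomes `Θ ∘ Ad T` on `G₀`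
(smooth, compact support transported); the torus orbital integrals AGREE AT THE SAME `z` (★ `integral_comp_conj_eq_integral_map_symm_of_signs`), `ρ′Δ` and the 8-ray functional are
frame-free, and `Θ ∘ Ad T = Θ` on the torus — so the letter's `Tendsto` statement for `(G, ν, Θ, ζ)` IS the one for `(G₀, ν₀, Θ ∘ Ad T, ζ)` with the same constant `c′`.
USE: prove the letter once per indefinite sign pattern at a CM frame (ROAD A), close `stub_L21` at every field by this transport.
HONEST LABEL: HC_CM is proved only modulo the printed citations until rung 0 closes; this file proves an implication between instances of one letter, nothing about the letter itself.

## References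
* [Rogawski1990] J. D. Rogawski, *Automorphic Representations of Unitary Groups in Three Variables*, Ann. of Math. Stud. 123 (1990), §8.4 pp. 126–127.
* [PlatonovRapinchuk1994] V. Platonov, A. Rapinchuk, *Algebraic Groups and Number Theory* (1994), §2.3.
-/

set_option autoImplicit false

noncomputable section

open MeasureTheory Measure Filter Topology NumberField NumberField.InfinitePlace Matrix
open Literature.NumberTheory.Automorphic Literature.NumberTheory.Automorphic.UnitaryGroup
open scoped Matrix.Norms.Operator

namespace Literature.NumberTheory.Rogawski1990

section OfSigns

variable (L : Type) [Field L] (α : Fin 3 → L) (w : {w : InfinitePlace L // IsComplex w})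
variable (L₀ : Type) [Field L₀] (α₀ : Fin 3 → L₀) (w₀ : {w : InfinitePlace L₀ // IsComplex w})

/-- Same sign pattern: the indefiniteness guard transports (`a_i a_j < 0 ⇒ a₀_i a₀_j < 0`). [cite: Rogawski1990, §8.4 p. 126] -/
theorem exists_mul_re_neg_of_signs (hsame : ∀ i, 0 < (w.1.embedding (α i)).re * (w₀.1.embedding (α₀ i)).re)
    (hind : ∃ i j : Fin 3, (w.1.embedding (α i)).re * (w.1.embedding (α j)).re < 0) :
    ∃ i j : Fin 3, (w₀.1.embedding (α₀ i)).re * (w₀.1.embedding (α₀ j)).re < 0 := by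
  obtain ⟨i, j, h⟩ := hind
  refine ⟨i, j, ?_⟩
  nlinarith [mul_pos (hsame i) (hsame j), h, hsame i, hsame j]

/-- Same sign pattern with non-zero reals: the source frame is non-degenerate (`α₀ i ≠ 0`). [cite: Rogawski1990, §8.4 p. 126] -/
theorem ne_zero_of_signs (hsame : ∀ i, 0 < (w.1.embedding (α i)).re * (w₀.1.embedding (α₀ i)).re) (i : Fin 3) : α₀ i ≠ 0 := by
  intro h
  have := hsame i
  rw [h, map_zero, Complex.zero_re, mul_zero] at this
  exact lt_irrefl _ this

/-- **(G) THE LETTER DEPENDS ONLY ON THE SIGN PATTERN.**  If `σ_w(α_i)`, `σ_{w₀}(α₀_i)` are real with `re σ_w(α_i) · re σ_{w₀}(α₀_i) > 0` for every `i`, then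
`ArchCentralLimitFormulaRankTwo L₀ α₀ w₀ → ArchCentralLimitFormulaRankTwo L α w` (sign frame ≃ₜ*, Haar pulled back, `Θ ↦ Θ ∘ Ad T`, torus orbital integrals agree at the same `z`).
[cite: Rogawski1990, §8.4 pp. 126–127] [cite: PlatonovRapinchuk1994, §2.3] -/
theorem archCentralLimitFormulaRankTwo_of_signs (hreal : ∀ i, (w.1.embedding (α i)).im = 0) (hreal₀ : ∀ i, (w₀.1.embedding (α₀ i)).im = 0)
    (hsame : ∀ i, 0 < (w.1.embedding (α i)).re * (w₀.1.embedding (α₀ i)).re)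
    (h₀ : ArchCentralLimitFormulaRankTwo L₀ α₀ w₀) : ArchCentralLimitFormulaRankTwo L α w := by
  intro _ _ _ _ hα hreal' hind ν _ _
  -- topology and Borel structure on the source frame `G₀`
  haveI : LocallyCompactSpace (archLocal L₀ 3 (Matrix.diagonal α₀) w₀) := locallyCompactSpace_archLocal L₀ 3 (Matrix.diagonal α₀) w₀
  haveI : SecondCountableTopology (archLocal L₀ 3 (Matrix.diagonal α₀) w₀) := secondCountableTopology_archLocal L₀ 3 (Matrix.diagonal α₀) w₀
  letI : MeasurableSpace (archLocal L₀ 3 (Matrix.diagonal α₀) w₀) := borel _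
  haveI : BorelSpace (archLocal L₀ 3 (Matrix.diagonal α₀) w₀) := ⟨rfl⟩
  -- the sign frame and the pulled-back Haar measure
  obtain ⟨T, e, he, hez, hTz⟩ := exists_continuousMulEquiv_archLocal_of_signs L α w L₀ α₀ w₀ hreal hreal₀ hsame
  haveI := isHaarMeasure_map_symm_of_signs L α w L₀ α₀ w₀ e ν
  haveI := isMulRightInvariant_map_symm_of_signs L α w L₀ α₀ w₀ e ν
  obtain ⟨c, hc, hmain⟩ := h₀ (ne_zero_of_signs L α w L₀ α₀ w₀ hsame) hreal₀ (exists_mul_re_neg_of_signs L α w L₀ α₀ w₀ hsame hind) (ν.map e.symm)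
  refine ⟨c, hc, fun Θ hΘ hsupp ζ => ?_⟩
  -- the letter at `(G₀, ν.map e⁻¹, Θ ∘ Ad T, ζ)`
  have key := hmain (fun M : Matrix (Fin 3) (Fin 3) ℂ => Θ ((T : Matrix (Fin 3) (Fin 3) ℂ) * M * ((T⁻¹ : GL (Fin 3) ℂ) : Matrix (Fin 3) (Fin 3) ℂ)))
    (hΘ.comp ((contDiff_const.mul contDiff_id).mul contDiff_const))
    (hasCompactSupport_comp_conj_of_signs L α w L₀ α₀ w₀ T e he hsupp) ζ
  have hΦ : ∀ r : Fin 3 → Circle,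
      ∫ u, Θ ((T : Matrix (Fin 3) (Fin 3) ℂ) *
          (((u * ⟨circleDiagonal 3 r, circleDiagonal_mem_archLocal_diagonal L₀ 3 α₀ w₀ r⟩ * u⁻¹ : archLocal L₀ 3 (Matrix.diagonal α₀) w₀) : GL (Fin 3) ℂ) : Matrix (Fin 3) (Fin 3) ℂ) *
          ((T⁻¹ : GL (Fin 3) ℂ) : Matrix (Fin 3) (Fin 3) ℂ)) ∂(ν.map e.symm) =
        ∫ g, Θ (((g * ⟨circleDiagonal 3 r, circleDiagonal_mem_archLocal_diagonal L 3 α w r⟩ * g⁻¹ : archLocal L 3 (Matrix.diagonal α) w) : GL (Fin 3) ℂ) : Matrix (Fin 3) (Fin 3) ℂ) ∂ν :=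
    fun r => (integral_comp_conj_eq_integral_map_symm_of_signs L α w L₀ α₀ w₀ T e he hez ν Θ r).symm
  have hcen := comp_conj_circleDiagonal_of_signs (E := ℂ) T hTz Θ (fun _ : Fin 3 => ζ)
  simp only [hΦ, hcen] at key
  exact key

end OfSigns

end Literature.NumberTheory.Rogawski1990

end
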